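import Summits.QuantumFields.YangMills.Theorems.BalabanUVNodesN08Thm2AtRecordLevelZero
import Summits.QuantumFields.Balaban3D.Proofs.FamilyLE

/-!
# BalabanUVNodes ∕ N08 — [Balaban1985UV3] Thm 2 at the runs of record: the LEVEL-0 WINDOW CONDITION AT THE FAMILY'S COUPLING CEILING
# (`g₀ ≤ γ ≤ e^{1−p₀}` ⇒ `ε₁(0) ≤ γp(γ)`), the print-natural form of `LevelZero` §3

Track A, DAG node N08 = T. Bałaban, CMP **102** (1985) 255–275 [Balaban1985UV3], (4) p. 256, (7) p. 257 «ε₁ = g₀p(g₀), p(g) = b₀(1 + log g⁻¹)^{p₀}», p. 259 L1 «For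
g₀ sufficiently small», p. 256 L16–17 «ε₀ … depending on the coupling constant g only»; [7] = [Balaban1985Variational] (2) p. 278.  Cell `pub-ymgap`, width seat
`pub-ymgap-dag-n08-w1`, W-SEAT-START-LIST §n08 item 1 (file 5); `--supports` K1⁷ `StabilityBAtRecordR13SepCoPH` (helper).  Companion of
`BalabanUVNodesN08Thm2AtRecordLevelZero` §2–§3: there (47)₀ at the record's binders ⟺ the (4)-window `PlaqSmall (ε₁ 0)` (non-flat part) inside [7]'s level-0
class, and the CRUDE sufficient condition `b₀p₀^{p₀}e^{1−p₀} ≤ εbg` from `g₀ ≤ 1`.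

WHAT THIS FILE PROVES (kernel; theorems only).  The window (7) `g ↦ g·p(g) = b₀ g (1 + log g⁻¹)^{p₀}` is INCREASING on `(0, e^{1−p₀}]` (`mul_pFun_mono`, from
the tangent-line inequality `log x ≤ x − 1`: `rpow_mul_exp_neg_antitone`), so **on a family whose couplings stay below a ceiling `γ ≤ e^{1−p₀}` — print's «g₀
sufficiently small», the d = 3 lane's `g_k ≤ γ₀` on `g²ε₀ ≤ (min γ₀ 1)²` (`FamilyLE.gk_le_gamma0_of_le`) — `ε₁(0) ≤ γ·p(γ)`** (`eps1OfPrint_zero_le_of_ceiling`), and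
the print-natural side condition **`γ·p(γ) ≤ εbg`** («the (4)-window at the ceiling lies in [7]'s class») gives the level-0 window, hence (41)₀ ∧ (47)₀ at the
record's binders, at every such lattice approximation (`window_of_ceiling`, `step0_of_ceiling`; on the lane's `≤`-family: `window_of_le_family`,
`step0_of_le_family`).  Non-vacuity (A6): `exists_ceiling_consts`.

HONEST FRAMING: count-neutral helper; N08 NOT discharged; nothing of [B10] asserted; one finite 𝕋⁴ programme at fixed ε, Bałaban AS PRINTED; nothing continuum ∕ ℝ⁴ ∕
OS ∕ mass gap ∕ Clay.  No `sorry`, standard axioms.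
-/

noncomputable section

namespace Summit.QuantumFields.YangMills.BalabanUVNodes.N08Thm2AtRecordWindowCeiling

open Literature.MathematicalPhysics.QuantumFieldTheory.Balaban1983to89
open Literature.MathematicalPhysics.QuantumFieldTheory.Balaban1983to89.Node00 (SU)
open Literature.MathematicalPhysics.QuantumFieldTheory.Balaban1983to89.B10RunsOfRecord
open Literature.MathematicalPhysics.QuantumFieldTheory.Balaban1985CMP102
open Literature.MathematicalPhysics.QuantumFieldTheory.Balaban1985CMP102.Setting
open Summit.QuantumFields.Balaban3D.Proofs
open Summit.QuantumFields.YangMills.BalabanUVNodes.N08Thm2AtRecordLevelZero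

/-! ## §1 The window `g·p(g)` is increasing below `e^{1−p₀}` -/
section RealAnalysis

/-- **`(1+u)^p e^{−u}` is DECREASING in `u` on `[p − 1, ∞)`** (`p > 0`): for `p − 1 ≤ v ≤ u` (`v > −1`), `(1+u)^p e^{−u} ≤ (1+v)^p e^{−v}` — from
`log((1+u)/(1+v)) ≤ (1+u)/(1+v) − 1 = (u − v)/(1+v)` and `p ≤ 1 + v`. [folklore] -/
theorem rpow_mul_exp_neg_antitone (p u v : ℝ) (hp : 0 < p) (hv : p - 1 ≤ v) (huv : v ≤ u) :
    (1 + u) ^ p * Real.exp (-u) ≤ (1 + v) ^ p * Real.exp (-v) := by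
  have hb : 0 < 1 + v := by linarith
  have ha : 0 < 1 + u := by linarith
  rw [Real.rpow_def_of_pos ha, Real.rpow_def_of_pos hb, ← Real.exp_add, ← Real.exp_add]
  apply Real.exp_le_exp.mpr
  -- `p (log(1+u) − log(1+v)) ≤ u − v`
  have hlog : Real.log (1 + u) - Real.log (1 + v) ≤ (u - v) / (1 + v) := by
    rw [← Real.log_div ha.ne' hb.ne']
    have h := Real.log_le_sub_one_of_pos (div_pos ha hb)
    have hid : (1 + u) / (1 + v) - 1 = (u - v) / (1 + v) := by field_simp; ring
    linarith [hid]
  have hkey : p * (Real.log (1 + u) - Real.log (1 + v)) ≤ u - v := by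
    calc p * (Real.log (1 + u) - Real.log (1 + v)) ≤ p * ((u - v) / (1 + v)) := mul_le_mul_of_nonneg_left hlog hp.le
      _ ≤ (1 + v) * ((u - v) / (1 + v)) := mul_le_mul_of_nonneg_right (by linarith) (div_nonneg (by linarith) hb.le)
      _ = u - v := by field_simp
  nlinarith [hkey]

/-- **`g·p(g) ≤ γ·p(γ)` for `0 < g ≤ γ ≤ e^{1−p₀}`** (`b₀ ≥ 0`, `p₀ > 0`): the window (7) is increasing below `e^{1−p₀}` (`u = log g⁻¹ ≥ log γ⁻¹ ≥ p₀ − 1`).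
[cite: Balaban1985UV3, (7) p.257 (real analysis of the printed window)] -/
theorem mul_pFun_mono (b₀ p₀ g γ : ℝ) (hb : 0 ≤ b₀) (hp : 0 < p₀) (hg : 0 < g) (hgγ : g ≤ γ) (hγ : γ ≤ Real.exp (1 - p₀)) :
    g * B10.pFun b₀ p₀ g ≤ γ * B10.pFun b₀ p₀ γ := by
  have hγ0 : 0 < γ := lt_of_lt_of_le hg hgγ
  have hgexp : g = Real.exp (-Real.log g⁻¹) := by rw [Real.log_inv, neg_neg, Real.exp_log hg]
  have hγexp : γ = Real.exp (-Real.log γ⁻¹) := by rw [Real.log_inv, neg_neg, Real.exp_log hγ0]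
  have hv : p₀ - 1 ≤ Real.log γ⁻¹ := by
    rw [Real.log_inv]
    have h := Real.log_le_log hγ0 hγ
    rw [Real.log_exp] at h
    linarith
  have huv : Real.log γ⁻¹ ≤ Real.log g⁻¹ := by
    rw [Real.log_inv, Real.log_inv]
    exact neg_le_neg (Real.log_le_log hg hgγ)
  have hcore := rpow_mul_exp_neg_antitone p₀ (Real.log g⁻¹) (Real.log γ⁻¹) hp hv huv
  calc g * B10.pFun b₀ p₀ g = b₀ * ((1 + Real.log g⁻¹) ^ p₀ * Real.exp (-Real.log g⁻¹)) := by
        unfold B10.pFun; rw [← hgexp]; ring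
    _ ≤ b₀ * ((1 + Real.log γ⁻¹) ^ p₀ * Real.exp (-Real.log γ⁻¹)) := mul_le_mul_of_nonneg_left hcore hb
    _ = γ * B10.pFun b₀ p₀ γ := by unfold B10.pFun; rw [← hγexp]; ring

end RealAnalysis

/-! ## §2 The window at the record's binders from a coupling ceiling -/
section Ceiling

variable {N : ℕ} [NeZero N] {L : ℕ}

/-- **`ε₁(0) ≤ γ·p(γ)` when `g₀ ≤ γ ≤ e^{1−p₀}`** (`b₀ ≥ 0`, `p₀ > 0`). [cite: Balaban1985UV3, (7) p.257 + p.259 L1 «For g₀ sufficiently small»] -/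
theorem eps1OfPrint_zero_le_of_ceiling (c : Consts L) (hb : 0 ≤ c.b₀) (hp : 0 < c.p₀) (S : Scales L) {γ : ℝ} (hgγ : S.gk 0 ≤ γ)
    (hγ : γ ≤ Real.exp (1 - c.p₀)) : eps1OfPrint c S 0 ≤ γ * B10.pFun c.b₀ c.p₀ γ :=
  mul_pFun_mono c.b₀ c.p₀ (S.gk 0) γ hb hp (ScalesArithmetic.gk_pos S 0) hgγ hγ

/-- **THE PRINT-NATURAL WINDOW CONDITION**: a coupling ceiling `g₀ ≤ γ ≤ e^{1−p₀}` and «the (4)-window at the ceiling lies in [7]'s class», `γ·p(γ) ≤ εbg`, put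
the level-0 (4)-window inside [7]'s level-0 class. [cite: Balaban1985UV3, (4) p.256 + (7) p.257; Balaban1985Variational, (2) p.278] -/
theorem window_of_ceiling (c : Consts L) (hb : 0 ≤ c.b₀) (hp : 0 < c.p₀) {γ : ℝ} (hγ : γ ≤ Real.exp (1 - c.p₀))
    (hε : γ * B10.pFun c.b₀ c.p₀ γ ≤ c.εbg) (S : Scales L) (hgγ : S.gk 0 ≤ γ) (V : GaugeField S.P 0 (SU N))
    (hV : PlaqSmall (eps1OfPrint c S 0) V) : PlaqSmall (c.εbg * S.eta 0 ^ 2) V := by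
  rw [plaqSmall_eta_zero_iff]
  exact plaqSmall_mono ((eps1OfPrint_zero_le_of_ceiling c hb hp S hgγ hγ).trans hε) hV

variable {𝔞 : ∀ S : Scales L, ∀ j, Averaging S.P j (SU N)} {𝔗 : ∀ S : Scales L, ∀ j, RTOpI S.P j (SU N) (𝔞 S j)}
  {c : Consts L} {S : Scales L} {W : SectB.TowerObjects S (SU N)}

/-- **(41)₀ ∧ (47)₀ AT THE RECORD'S BINDERS from a coupling ceiling** (`LevelZero.step0_of_window` + `window_of_ceiling`). [cite: Balaban1985UV3, (1) p.256 + (41) p.266 + (47) p.267 + (7) p.257] -/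
theorem step0_of_ceiling (hW : W.toRunObjects = runObjects₀A N 𝔞 𝔗 (Backgrounds.ofAvg N L 𝔞) c S) (hb : 0 ≤ c.b₀) (hp : 0 < c.p₀) {γ : ℝ}
    (hγ : γ ≤ Real.exp (1 - c.p₀)) (hε : γ * B10.pFun c.b₀ c.p₀ γ ≤ c.εbg) (hgγ : S.gk 0 ≤ γ)
    (hP0 : ∀ (h : W.Hist 0) (V : GaugeField S.P 0 (SU N)), W.Pint 0 h V = 0)
    (hLF : ∀ (V : GaugeField S.P 0 (SU N)) (F : W.Hist 0 → ℝ), Real.exp (F (W.triv 0)) ≤ W.LF 0 V F) :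
    B10.Step0Printed W.pin.toTowerRun :=
  step0_of_window hW hP0 hLF (window_of_ceiling c hb hp hγ hε S hgγ)

/-- **On the d = 3 lane's `≤`-family `g²ε₀ ≤ (min γ₀ 1)²`** every coupling is `≤ γ₀` (`FamilyLE.gk_le_gamma0_of_le`), so `γ₀ ≤ e^{1−p₀}` and `γ₀p(γ₀) ≤ εbg` give the
level-0 window at every member. [cite: Balaban1985UV3, (4) p.256 + (7) p.257 + p.256 L16–17] -/
theorem window_of_le_family (c : Consts L) (hb : 0 ≤ c.b₀) (hp : 0 < c.p₀) {γ₀ : ℝ} (hγ₀ : 0 ≤ γ₀) (hγ : γ₀ ≤ Real.exp (1 - c.p₀))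
    (hε : γ₀ * B10.pFun c.b₀ c.p₀ γ₀ ≤ c.εbg) (S : Scales L) (hle : S.g ^ 2 * S.ε₀ ≤ (min γ₀ 1) ^ 2) (V : GaugeField S.P 0 (SU N))
    (hV : PlaqSmall (eps1OfPrint c S 0) V) : PlaqSmall (c.εbg * S.eta 0 ^ 2) V :=
  window_of_ceiling c hb hp hγ hε S (FamilyLE.gk_le_gamma0_of_le S hγ₀ hle 0 (Nat.zero_le _)) V hV

/-- … hence (41)₀ ∧ (47)₀ at the record's binders at every member of the `≤`-family. [cite: Balaban1985UV3, (1) p.256 + (41) p.266 + (47) p.267] -/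
theorem step0_of_le_family (hW : W.toRunObjects = runObjects₀A N 𝔞 𝔗 (Backgrounds.ofAvg N L 𝔞) c S) (hb : 0 ≤ c.b₀) (hp : 0 < c.p₀) {γ₀ : ℝ}
    (hγ₀ : 0 ≤ γ₀) (hγ : γ₀ ≤ Real.exp (1 - c.p₀)) (hε : γ₀ * B10.pFun c.b₀ c.p₀ γ₀ ≤ c.εbg) (hle : S.g ^ 2 * S.ε₀ ≤ (min γ₀ 1) ^ 2)
    (hP0 : ∀ (h : W.Hist 0) (V : GaugeField S.P 0 (SU N)), W.Pint 0 h V = 0)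
    (hLF : ∀ (V : GaugeField S.P 0 (SU N)) (F : W.Hist 0 → ℝ), Real.exp (F (W.triv 0)) ≤ W.LF 0 V F) :
    B10.Step0Printed W.pin.toTowerRun :=
  step0_of_window hW hP0 hLF (window_of_le_family c hb hp hγ₀ hγ hε S hle)

/-- **NON-VACUITY (A6)**: admissible constants and a ceiling meeting the print-natural window condition exist — e.g. `b₀ = 1`, `p₀ = 3`, `γ = e^{−2} = e^{1−p₀}`,
`εbg = 4 ≥ 27e^{−2} = γp(γ)` (`ε₀`, `E` the documented junk of `Consts.junk`). [cite: Balaban1985UV3, (7) p.257 (bookkeeping)] -/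
theorem exists_ceiling_consts (L : ℕ) :
    ∃ (c : Consts L) (γ : ℝ), c.Adm ∧ 0 < γ ∧ γ ≤ Real.exp (1 - c.p₀) ∧ γ * B10.pFun c.b₀ c.p₀ γ ≤ c.εbg := by
  refine ⟨{ Consts.junk L with εbg := 4 }, Real.exp (1 - 3), ?_, Real.exp_pos _, le_rfl, ?_⟩
  · obtain ⟨h1, h2, h3, -⟩ := Consts.junk_adm L
    exact ⟨h1, h2, h3, by show (0 : ℝ) < 4; norm_num⟩
  · show Real.exp (1 - 3) * (1 * (1 + Real.log (Real.exp (1 - 3))⁻¹) ^ (3 : ℝ)) ≤ 4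
    rw [Real.log_inv, Real.log_exp, show (1 : ℝ) + -(1 - 3) = 3 by norm_num,
      show (3 : ℝ) ^ (3 : ℝ) = 27 by rw [show (3 : ℝ) = ((3 : ℕ) : ℝ) by norm_num, Real.rpow_natCast]; norm_num, one_mul]
    have h1 := Real.exp_one_gt_d9
    have he : Real.exp (1 - 3) * (Real.exp 1 * Real.exp 1) = 1 := by rw [← Real.exp_add, ← Real.exp_add]; norm_num
    nlinarith [Real.exp_pos (1 - 3), mul_pos (Real.exp_pos 1) (Real.exp_pos 1)]

end Ceiling


/-! ## §3 (v1.1, append-only) A witness in the PROPER regime `εbg ≤ 2` (answer to ref-L READ row 7 NIT-1 on the `εbg := 4` witnesses) -/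
section ProperWitness

/-- **NON-VACUITY IN THE PROPER REGIME**: admissible constants with class radius `εbg = 1` (so at level 0 [7]'s class is a PROPER subset of the configurations of
`SU(N)`, `N ≥ 2`, and the window is a genuine constraint) and a ceiling `γ = e^{−9} ≤ e^{1−p₀}` with `γ·p(γ) = 1000e^{−9} ≤ 1 = εbg` (`b₀ = 1`, `p₀ = 3`, `ε₀`, `E`
the documented junk of `Consts.junk`).  Answers the lane referee's NIT that the `εbg := 4` witnesses (`LevelZero.exists_consts_adm_window`, `exists_ceiling_consts`) trivialise
the class. [cite: Balaban1985UV3, (7) p.257 + p.259 L1 (bookkeeping)] -/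
theorem exists_ceiling_consts_proper (L : ℕ) :
    ∃ (c : Consts L) (γ : ℝ), c.Adm ∧ c.εbg ≤ 1 ∧ 0 < γ ∧ γ ≤ Real.exp (1 - c.p₀) ∧ γ * B10.pFun c.b₀ c.p₀ γ ≤ c.εbg := by
  refine ⟨Consts.junk L, Real.exp (-9), Consts.junk_adm L, by show (1 : ℝ) ≤ 1; exact le_rfl, Real.exp_pos _, ?_, ?_⟩
  · show Real.exp (-9) ≤ Real.exp (1 - 3)
    exact Real.exp_le_exp.mpr (by norm_num)
  · show Real.exp (-9) * (1 * (1 + Real.log (Real.exp (-9))⁻¹) ^ (3 : ℝ)) ≤ 1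
    have hten : (1 : ℝ) + -(-9 : ℝ) = 10 := by norm_num
    rw [Real.log_inv, Real.log_exp, hten,
      show (10 : ℝ) ^ (3 : ℝ) = 1000 by rw [show (3 : ℝ) = ((3 : ℕ) : ℝ) by norm_num, Real.rpow_natCast]; norm_num, one_mul]
    have h1 := Real.exp_one_gt_d9
    have h3 : Real.exp 3 = Real.exp 1 * Real.exp 1 * Real.exp 1 := by rw [← Real.exp_add, ← Real.exp_add]; norm_num
    have h3' : 19 < Real.exp 3 := by
      rw [h3]; nlinarith [Real.exp_pos 1, mul_pos (Real.exp_pos 1) (Real.exp_pos 1)]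
    have h9 : Real.exp 9 = Real.exp 3 * Real.exp 3 * Real.exp 3 := by rw [← Real.exp_add, ← Real.exp_add]; norm_num
    have h9' : 1000 < Real.exp 9 := by
      rw [h9]; nlinarith [Real.exp_pos 3, mul_pos (Real.exp_pos 3) (Real.exp_pos 3)]
    have hinv : Real.exp (-9) * Real.exp 9 = 1 := by rw [← Real.exp_add]; norm_num
    have hlt := mul_lt_mul_of_pos_left h9' (Real.exp_pos (-9))
    linarith

end ProperWitness

end Summit.QuantumFields.YangMills.BalabanUVNodes.N08Thm2AtRecordWindowCeiling

end
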